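import Mathlib
import Literature.ModelTheory.ExponentialFields.SemialgebraicInterior
import Summits.KontsevichZagierPeriods.KontsevichZagierPeriods.Theorems.InverseLandauTateFamilyKernelStubLinDensity

/-!
# Crux `TateFamilyKernel` (stmt-KontsevichZagierPeriods-9130), line `Sketch`: `stub_sfDensity`

Step 2 (PUSHFORWARD DENSITY) of the symmetric-fold class `Q = 1 − ϖ z₁(1−z₁)(α + βz₂)`, `P`
`ϖ`-free and even under `z₁ ↦ 1 − z₁` (`0 < α`, `0 < β`), in the lead's skeleton for the crux
`Summit.KontsevichZagierPeriods.KontsevichZagierPeriods.Theses.InverseLandau.TateFamilyKernel`.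

Write `u(x) = x(1−x)`, `w(s) = α + βs`, `T(z) = u(z₁)w(z₂) : (0,1)² → (0,(α+β)/4)`.  If all moments
`∫_{(0,1)²} P T^M` vanish, the pushforward of `P dz` under `T` is zero; we compute its density
`Φ` and conclude that `Φ(y) = 0`, which on `(α/4,(α+β)/4)` is (twice) the integral in the statement.
To keep every integrand bounded we use the coordinates `(y, σ) = (T, √(w − 4T))` on the half square
`x < ½` (by evenness the other half contributes the same), in which `P dx ds = 2P/(β√(4y+σ²)) dy dσ`
has no singularity; the map `(x,s) ↦ (σ,y)` factors as two AFFINE one-dimensional substitutions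
(`σ = √(w(s))(1−2x)` at fixed `s`, then `y = (w(s) − σ²)/4` at fixed `σ`) separated by a Fubini
swap, so only Mathlib's `intervalIntegral.integral_comp_*` lemmas and Fubini for
indicator-times-continuous integrands on rectangles are needed.  The density
`Φ(y) = ∫_{√(α−4y)}^{√(α+β−4y)} 2P((1−σ/√(4y+σ²))/2, (4y+σ²−α)/β)/(β√(4y+σ²)) dσ` is a proper
parametric integral, hence continuous, so Weierstrass
(`LinDensity.eq_zero_of_forall_moment_eq_zero`) gives `Φ ≡ 0` on `(0,(α+β)/4)`; finally for
`y ∈ (α/4,(α+β)/4)` the non-affine substitution `s = (4y+σ²−α)/β`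
(`MeasureTheory.integral_image_eq_integral_abs_deriv_smul`, no integrability needed) identifies
`Φ(y)` with `2∫_{(4y−α)/β}^{1} P((1−√(1−4y/w))/2, s)/(w√(1−4y/w)) ds`, `w = α + βs`.

References: Kontsevich–Zagier 2001, §1.2.  Mathlib plus the helpers of the linear class
(`…Descent.LinDensity`, file `InverseLandauTateFamilyKernelStubLinDensity`); no named fact, no new
definition.  Helpers live in the sub-namespace `SfDensity`.
-/

noncomputable section

open MeasureTheory Set MvPolynomial
open Literature.ModelTheory.ExponentialFields (continuous_aeval_real)

namespace Summit.KontsevichZagierPeriods.InverseLandau.TateFamilyKernel.Descent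

namespace SfDensity

/-- Folding an integrand symmetric under `x ↦ 1 − x`: `∫_{(0,1)} g = 2∫_{(0,½)} g`. [folklore] -/
theorem setIntegral_Ioo_unit_of_symm (g : ℝ → ℝ) (hg : Continuous g) (he : ∀ x, g (1 - x) = g x) :
    ∫ x in Ioo (0 : ℝ) 1, g x = 2 * ∫ x in Ioo (0 : ℝ) (1 / 2), g x := by
  have h2 : ∫ x in (1 / 2 : ℝ)..1, g x = ∫ x in (0 : ℝ)..(1 / 2), g x := by
    have h := intervalIntegral.integral_comp_sub_left (a := 0) (b := 1 / 2) g 1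
    simp_rw [he] at h
    rw [h]
    norm_num
  rw [← integral_Ioc_eq_integral_Ioo, ← intervalIntegral.integral_of_le zero_le_one,
    ← intervalIntegral.integral_add_adjacent_intervals (hg.intervalIntegrable 0 (1 / 2))
      (hg.intervalIntegrable (1 / 2) 1), h2, ← two_mul,
    intervalIntegral.integral_of_le (by norm_num : (0 : ℝ) ≤ 1 / 2), integral_Ioc_eq_integral_Ioo]

/-- The affine substitution `x = (1 − σ/c)/2` (`0 < c ≤ K`) from `x ∈ (0,½)` to `σ ∈ (0,c)`, the new
integrand extended by zero to `σ ∈ (0,K)`; no hypothesis on `g`. [folklore] -/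
theorem setIntegral_Ioo_half_affine (g : ℝ → ℝ) {c K : ℝ} (hc : 0 < c) (hcK : c ≤ K) :
    ∫ x in Ioo (0 : ℝ) (1 / 2), g x =
      ∫ σ in Ioo (0 : ℝ) K, (Iio c).indicator (fun σ => (2 * c)⁻¹ * g ((1 - σ / c) / 2)) σ := by
  have hsub : ∫ σ in (0 : ℝ)..c, g ((1 - σ / c) / 2) = (2 * c) * ∫ x in (0 : ℝ)..(1 / 2), g x := by
    have h := intervalIntegral.integral_comp_sub_div (a := 0) (b := c) g
      (mul_ne_zero two_ne_zero hc.ne') (1 / 2)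
    have e : ∀ σ : ℝ, (1 - σ / c) / 2 = 1 / 2 - σ / (2 * c) := fun σ => by
      field_simp
    simp_rw [e, h, smul_eq_mul, zero_div, sub_zero]
    rw [show (1 : ℝ) / 2 - c / (2 * c) = 0 by field_simp; ring]
  calc ∫ x in Ioo (0 : ℝ) (1 / 2), g x
      = ∫ x in (0 : ℝ)..(1 / 2), g x := by
        rw [intervalIntegral.integral_of_le (by norm_num), integral_Ioc_eq_integral_Ioo]
    _ = ∫ σ in (0 : ℝ)..c, (2 * c)⁻¹ * g ((1 - σ / c) / 2) := by
        rw [intervalIntegral.integral_const_mul, hsub, ← mul_assoc,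
          inv_mul_cancel₀ (by positivity), one_mul]
    _ = ∫ σ in Ioo 0 c, (2 * c)⁻¹ * g ((1 - σ / c) / 2) := by
        rw [intervalIntegral.integral_of_le hc.le, integral_Ioc_eq_integral_Ioo]
    _ = _ := by rw [setIntegral_indicator measurableSet_Iio, Ioo_inter_Iio, min_eq_right hcK]

/-- The affine substitution `s = (4y + t − a)/b` (`0 < b`) in an integral over `s ∈ (0,1)`; no
hypothesis on `h`. [folklore] -/
theorem setIntegral_Ioo_unit_affine (h : ℝ → ℝ) (a t : ℝ) {b : ℝ} (hb : 0 < b) :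
    ∫ s in Ioo (0 : ℝ) 1, h s =
      ∫ y in Ioo ((a - t) / 4) ((a + b - t) / 4), 4 / b * h ((4 * y + t - a) / b) := by
  have hle : (a - t) / 4 ≤ (a + b - t) / 4 := by linarith
  have hsub := intervalIntegral.integral_comp_mul_add (a := (a - t) / 4) (b := (a + b - t) / 4) h
    (c := 4 / b) (by positivity) ((t - a) / b)
  rw [show 4 / b * ((a - t) / 4) + (t - a) / b = 0 by field_simp; ring,
    show 4 / b * ((a + b - t) / 4) + (t - a) / b = 1 by field_simp; ring,
    intervalIntegral.integral_of_le hle, integral_Ioc_eq_integral_Ioo] at hsub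
  symm
  calc ∫ y in Ioo ((a - t) / 4) ((a + b - t) / 4), 4 / b * h ((4 * y + t - a) / b)
      = 4 / b * ∫ y in Ioo ((a - t) / 4) ((a + b - t) / 4), h (4 / b * y + (t - a) / b) := by
        rw [← integral_const_mul]
        refine setIntegral_congr_fun measurableSet_Ioo fun y _ => ?_
        rw [show (4 * y + t - a) / b = 4 / b * y + (t - a) / b by ring]
    _ = ∫ s in Ioo (0 : ℝ) 1, h s := by
        rw [hsub, smul_eq_mul, ← mul_assoc, mul_inv_cancel₀ (by positivity), one_mul,
          intervalIntegral.integral_of_le zero_le_one, integral_Ioc_eq_integral_Ioo]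

/-- The fold algebra: with `x = (1 − σ/√C)/2` one has `x(1−x)·C = (C − σ²)/4` (`0 < C`).
[folklore] -/
theorem fold_mul_eq {C : ℝ} (hC : 0 < C) (σ : ℝ) :
    (1 - σ / √C) / 2 * (1 - (1 - σ / √C) / 2) * C = (C - σ ^ 2) / 4 := by
  have h := Real.sq_sqrt hC.le
  have hc : 0 < √C := Real.sqrt_pos.2 hC
  set c := √C
  rw [← h]
  field_simp
  ring

end SfDensity

open LinDensity SfDensity in
/-- **Stub `stub_sfDensity`** (symmetric-fold class `Q = 1 − ϖ z₁(1−z₁)(α+βz₂)`, `P` `ϖ`-free and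
even in `z₁ ↦ 1 − z₁`, step 2: PUSHFORWARD DENSITY).  If all moments
`∫_{(0,1)²} P(z)·(z₁(1−z₁)(α+βz₂))^M dz` vanish (`0 < α`, `0 < β`), then for every
`y ∈ (α/4, (α+β)/4)`,
`∫_{(4y−α)/β}^{1} P((1 − √(1−4y/(α+βs)))/2, s) / ((α+βs)√(1−4y/(α+βs))) ds = 0`.
Indeed, in the coordinates `(y,σ) = (T, √(α+βs−4T))` on `{z₁ < ½}` the density of `T_*(P dz)` is
`Φ(y) = ∫_{√(α−4y)}^{√(α+β−4y)} 2P((1−σ/√(4y+σ²))/2, (4y+σ²−α)/β)/(β√(4y+σ²)) dσ` (two affine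
substitutions and two Fubini swaps), a continuous function on `ℝ` with moments
`∫_0^{(α+β)/4} Φ(y) y^M dy = ∫ P·T^M = 0`, hence zero on `(0,(α+β)/4)` by Weierstrass
(`LinDensity.eq_zero_of_forall_moment_eq_zero`); for `y > α/4` the substitution
`s = (4y+σ²−α)/β` turns `Φ(y)` into twice the displayed integral.
[cite: KontsevichZagier2001, §1.2] -/
theorem stub_sfDensity (α β : ℚ) (P : MvPolynomial (Fin 2) ℚ) (hα : 0 < α) (hβ : 0 < β)
    (heven : ∀ z : Fin 2 → ℝ, aeval ![1 - z 0, z 1] P = aeval z P)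
    (hmom : ∀ M : ℕ, ∫ z in Set.pi Set.univ (fun _ : Fin 2 => Ioo (0 : ℝ) 1),
      aeval z P * (z 0 * (1 - z 0) * ((α : ℝ) + β * z 1)) ^ M = 0) :
    ∀ y ∈ Ioo ((α : ℝ) / 4) (((α : ℝ) + β) / 4), ∫ s in Ioo ((4 * y - α) / β) 1,
      aeval ![(1 - Real.sqrt (1 - 4 * y / ((α : ℝ) + β * s))) / 2, s] P /
        (((α : ℝ) + β * s) * Real.sqrt (1 - 4 * y / ((α : ℝ) + β * s))) = 0 := by
  have ha : (0 : ℝ) < α := by exact_mod_cast hα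
  have hb : (0 : ℝ) < β := by exact_mod_cast hβ
  set a : ℝ := (α : ℝ) with ha_def
  set b : ℝ := (β : ℝ) with hb_def
  -- the regularised weight `w s = a + b·max(s,0)` (`= a + b s` for `s ≥ 0`), continuous and `> 0`
  obtain ⟨w, hw_def⟩ : ∃ w : ℝ → ℝ, w = fun s => a + b * max s 0 := ⟨_, rfl⟩
  have hw_cont : Continuous w := by rw [hw_def]; fun_prop
  have hw_pos : ∀ s, 0 < w s := fun s => by
    rw [hw_def]; exact add_pos_of_pos_of_nonneg ha (mul_nonneg hb.le (le_max_right _ _))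
  have hws : ∀ s, 0 < s → w s = a + b * s := fun s hs => by
    rw [hw_def]; show a + b * max s 0 = a + b * s; rw [max_eq_left hs.le]
  have hsqrt_ne : ∀ s, √(w s) ≠ 0 := fun s => (Real.sqrt_pos.2 (hw_pos s)).ne'
  -- `S y σ` = the `s`-coordinate of the point of the half square with `T = y`, `√(w − 4T) = σ`
  obtain ⟨S, hS_def⟩ : ∃ S : ℝ → ℝ → ℝ, S = fun y σ => (4 * y + σ ^ 2 - a) / b := ⟨_, rfl⟩
  have hS_cont : Continuous fun q : ℝ × ℝ => S q.1 q.2 := by rw [hS_def]; fun_prop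
  have hwS : ∀ y σ, (a - σ ^ 2) / 4 < y → w (S y σ) = 4 * y + σ ^ 2 := fun y σ h => by
    have hS0 : 0 < S y σ := by rw [hS_def]; exact div_pos (by linarith) hb
    rw [hws _ hS0, hS_def]; field_simp; ring
  -- the density integrand `φ` (no singularity) and the density `Φ` of `T_*(P dz)`
  obtain ⟨φ, hφ_def⟩ : ∃ φ : ℝ → ℝ → ℝ, φ = fun y σ =>
      4 / b * ((2 * √(w (S y σ)))⁻¹ * aeval ![(1 - σ / √(w (S y σ))) / 2, S y σ] P) := ⟨_, rfl⟩
  have hφ_cont : Continuous (Function.uncurry φ) := by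
    have hc : Continuous fun q : ℝ × ℝ => √(w (S q.1 q.2)) :=
      Real.continuous_sqrt.comp (hw_cont.comp hS_cont)
    rw [hφ_def]
    exact continuous_const.mul (((continuous_const.mul hc).inv₀ fun q =>
      mul_ne_zero two_ne_zero (hsqrt_ne _)).mul ((continuous_aeval_real P).comp (continuous_vec_two
        ((continuous_const.sub (continuous_snd.div hc fun q => hsqrt_ne _)).div_const _) hS_cont)))
  obtain ⟨Φ, hΦ_def⟩ : ∃ Φ : ℝ → ℝ, Φ = fun y => ∫ σ in √(a - 4 * y)..√(a + b - 4 * y), φ y σ :=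
    ⟨_, rfl⟩
  have hΦ_cont : Continuous Φ := by
    have hI : ∀ y u v, IntervalIntegrable (φ y) volume u v := fun y u v =>
      (hφ_cont.uncurry_left y).intervalIntegrable u v
    have h : Φ = fun y => (∫ σ in (0 : ℝ)..√(a + b - 4 * y), φ y σ) -
        ∫ σ in (0 : ℝ)..√(a - 4 * y), φ y σ := by
      rw [hΦ_def]; funext y
      exact (intervalIntegral.integral_interval_sub_left (hI y _ _) (hI y _ _)).symm
    rw [h]
    exact (intervalIntegral.continuous_parametric_intervalIntegral_of_continuous hφ_cont
      (Real.continuous_sqrt.comp (by fun_prop))).sub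
      (intervalIntegral.continuous_parametric_intervalIntegral_of_continuous hφ_cont
      (Real.continuous_sqrt.comp (by fun_prop)))
  have hL : 0 < (a + b) / 4 := by positivity
  -- the moments of `Φ` on `[0, (a+b)/4]` are the moments `∫_□ P · T^M`, hence zero
  have hΦmom : ∀ M : ℕ, ∫ y in 0..(a + b) / 4, Φ y * y ^ M = 0 := by
    intro M
    -- (i) the square integral as an iterated integral, `s = z 1` outside
    have h1 : ∫ s in Ioo (0 : ℝ) 1, ∫ x in Ioo (0 : ℝ) 1,
        aeval ![x, s] P * (x * (1 - x) * (a + b * s)) ^ M = 0 := by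
      have h := hmom M
      rw [setIntegral_pi_Ioo_fin_two] at h
      simp only [Matrix.cons_val_zero, Matrix.cons_val_one] at h
      have hGc : Continuous fun p : ℝ × ℝ =>
          aeval ![p.1, p.2] P * (p.1 * (1 - p.1) * (a + b * p.2)) ^ M :=
        ((continuous_aeval_real P).comp
          (continuous_vec_two continuous_fst continuous_snd)).mul (by fun_prop)
      rwa [setIntegral_Ioo_prod_Ioo_symm _ hGc] at h
    -- the integrand in the coordinates `(s, σ)`, `σ = √(w s)(1 − 2x)`, zero-extended in `σ`
    obtain ⟨G, hG_def⟩ : ∃ G : ℝ × ℝ → ℝ, G = fun p => (2 * √(w p.1))⁻¹ *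
        (aeval ![(1 - p.2 / √(w p.1)) / 2, p.1] P * ((w p.1 - p.2 ^ 2) / 4) ^ M) := ⟨_, rfl⟩
    have hG_cont : Continuous G := by
      have hc : Continuous fun p : ℝ × ℝ => √(w p.1) :=
        Real.continuous_sqrt.comp (hw_cont.comp continuous_fst)
      rw [hG_def]
      exact ((continuous_const.mul hc).inv₀ fun p => mul_ne_zero two_ne_zero (hsqrt_ne _)).mul
        (((continuous_aeval_real P).comp (continuous_vec_two
          ((continuous_const.sub (continuous_snd.div hc fun p => hsqrt_ne _)).div_const _)
          continuous_fst)).mul ((((hw_cont.comp continuous_fst).sub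
            (continuous_snd.pow 2)).div_const _).pow M))
    obtain ⟨F₁, hF₁_def⟩ : ∃ F₁ : ℝ × ℝ → ℝ,
        F₁ = {p : ℝ × ℝ | p.2 < √(w p.1)}.indicator G := ⟨_, rfl⟩
    -- (ii) fold by evenness, then substitute `x = (1 − σ/√(w s))/2` at fixed `s`
    have h2 : ∫ s in Ioo (0 : ℝ) 1, ∫ σ in Ioo 0 √(a + b), F₁ (s, σ) = 0 := by
      have h : ∫ s in Ioo (0 : ℝ) 1, ∫ x in Ioo (0 : ℝ) 1,
          aeval ![x, s] P * (x * (1 - x) * (a + b * s)) ^ M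
          = ∫ s in Ioo (0 : ℝ) 1, 2 * ∫ σ in Ioo 0 √(a + b), F₁ (s, σ) := by
        refine setIntegral_congr_fun measurableSet_Ioo fun s hs => ?_
        have hc : 0 < √(w s) := Real.sqrt_pos.2 (hw_pos s)
        have hcK : √(w s) ≤ √(a + b) := Real.sqrt_le_sqrt (by rw [hws s hs.1]; nlinarith [hs.2])
        have hg : Continuous fun x : ℝ => aeval ![x, s] P * (x * (1 - x) * (a + b * s)) ^ M :=
          ((continuous_aeval_real P).comp (continuous_vec_two continuous_id continuous_const)).mul
            (by fun_prop)
        have he : ∀ x : ℝ, aeval ![1 - x, s] P * ((1 - x) * (1 - (1 - x)) * (a + b * s)) ^ M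
            = aeval ![x, s] P * (x * (1 - x) * (a + b * s)) ^ M := fun x => by
          rw [show aeval ![1 - x, s] P = aeval ![x, s] P by simpa using heven ![x, s]]; ring
        rw [setIntegral_Ioo_unit_of_symm _ hg he, setIntegral_Ioo_half_affine _ hc hcK]
        congr 1
        refine setIntegral_congr_fun measurableSet_Ioo fun σ _ => ?_
        simp only [hF₁_def, hG_def, Set.indicator_apply, mem_Iio, mem_setOf_eq]
        split_ifs
        · rw [← hws s hs.1, fold_mul_eq (hw_pos s)]
        · rfl
      rw [h, integral_const_mul] at h1
      exact (mul_eq_zero.1 h1).resolve_left two_ne_zero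
    -- (iii) Fubini: `σ` outside
    have hF₁_int : IntegrableOn F₁ (Ioo (0 : ℝ) 1 ×ˢ Ioo 0 √(a + b)) volume := by
      rw [hF₁_def]
      refine Integrable.indicator ?_ (measurableSet_lt measurable_snd
        (Real.continuous_sqrt.comp (hw_cont.comp continuous_fst)).measurable)
      exact (hG_cont.continuousOn.integrableOn_compact (isCompact_Icc.prod isCompact_Icc)).mono_set
        (Set.prod_mono Ioo_subset_Icc_self Ioo_subset_Icc_self)
    have h3 : ∫ σ in Ioo 0 √(a + b), ∫ s in Ioo (0 : ℝ) 1, F₁ (s, σ) = 0 := by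
      rw [← setIntegral_setIntegral_swap F₁ hF₁_int]; exact h2
    -- (iv) substitute `s = S y σ` (`y = (w s − σ²)/4 = T`) at fixed `σ`, zero-extended in `y`
    obtain ⟨F₂, hF₂_def⟩ : ∃ F₂ : ℝ × ℝ → ℝ, F₂ = ({q : ℝ × ℝ | (a - q.1 ^ 2) / 4 < q.2} ∩
        {q | q.2 < (a + b - q.1 ^ 2) / 4}).indicator (fun q => 4 / b * G (S q.2 q.1, q.1)) :=
      ⟨_, rfl⟩
    have h4 : ∫ σ in Ioo 0 √(a + b), ∫ y in Ioo 0 ((a + b) / 4), F₂ (σ, y) = 0 := by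
      refine Eq.trans (setIntegral_congr_fun measurableSet_Ioo fun σ hσ => ?_) h3
      have hset : Ioo (0 : ℝ) ((a + b) / 4) ∩ Ioo ((a - σ ^ 2) / 4) ((a + b - σ ^ 2) / 4)
          = Ioo ((a - σ ^ 2) / 4) ((a + b - σ ^ 2) / 4) ∩ Ioi 0 := by
        ext y; simp only [mem_inter_iff, mem_Ioo, mem_Ioi]
        constructor
        · rintro ⟨⟨h0, -⟩, hA, hB⟩; exact ⟨⟨hA, hB⟩, h0⟩
        · rintro ⟨⟨hA, hB⟩, h0⟩; exact ⟨⟨h0, by nlinarith⟩, hA, hB⟩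
      calc ∫ y in Ioo 0 ((a + b) / 4), F₂ (σ, y)
          = ∫ y in Ioo 0 ((a + b) / 4), (Ioo ((a - σ ^ 2) / 4) ((a + b - σ ^ 2) / 4)).indicator
              (fun y => 4 / b * G (S y σ, σ)) y := by
            refine setIntegral_congr_fun measurableSet_Ioo fun y _ => ?_
            simp only [hF₂_def, Set.indicator_apply, mem_inter_iff, mem_setOf_eq, mem_Ioo]
        _ = ∫ y in Ioo ((a - σ ^ 2) / 4) ((a + b - σ ^ 2) / 4), (Ioi 0).indicator
              (fun y => 4 / b * G (S y σ, σ)) y := by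
            rw [setIntegral_indicator measurableSet_Ioo, setIntegral_indicator measurableSet_Ioi,
              hset]
        _ = ∫ y in Ioo ((a - σ ^ 2) / 4) ((a + b - σ ^ 2) / 4), 4 / b * F₁ (S y σ, σ) := by
            refine setIntegral_congr_fun measurableSet_Ioo fun y hy => ?_
            have hiff : σ < √(w (S y σ)) ↔ 0 < y := by
              rw [hwS y σ hy.1, Real.lt_sqrt hσ.1.le]; constructor <;> intro h <;> nlinarith
            simp only [hF₁_def, Set.indicator_apply, mem_setOf_eq, mem_Ioi, hiff]
            split_ifs <;> simp
        _ = ∫ s in Ioo (0 : ℝ) 1, F₁ (s, σ) := by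
            rw [setIntegral_Ioo_unit_affine (fun s => F₁ (s, σ)) a (σ ^ 2) hb, hS_def]
    -- (v) Fubini: `y` outside
    have hF₂_int : IntegrableOn F₂ (Ioo 0 √(a + b) ×ˢ Ioo 0 ((a + b) / 4)) volume := by
      rw [hF₂_def]
      refine Integrable.indicator ?_ ((measurableSet_lt (by fun_prop) measurable_snd).inter
        (measurableSet_lt measurable_snd (by fun_prop)))
      have hc : Continuous fun q : ℝ × ℝ => 4 / b * G (S q.2 q.1, q.1) :=
        continuous_const.mul (hG_cont.comp
          ((hS_cont.comp (continuous_snd.prodMk continuous_fst)).prodMk continuous_fst))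
      exact (hc.continuousOn.integrableOn_compact (isCompact_Icc.prod isCompact_Icc)).mono_set
        (Set.prod_mono Ioo_subset_Icc_self Ioo_subset_Icc_self)
    have h5 : ∫ y in Ioo 0 ((a + b) / 4), ∫ σ in Ioo 0 √(a + b), F₂ (σ, y) = 0 := by
      rw [← setIntegral_setIntegral_swap F₂ hF₂_int]; exact h4
    -- (vi) the inner integral is `Φ y · y ^ M`
    have h6 : ∫ y in Ioo 0 ((a + b) / 4), Φ y * y ^ M = 0 := by
      refine Eq.trans (setIntegral_congr_fun measurableSet_Ioo fun y hy => ?_) h5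
      have hset : Ioo 0 √(a + b) ∩ ({σ : ℝ | (a - σ ^ 2) / 4 < y} ∩ {σ | y < (a + b - σ ^ 2) / 4})
          = Ioo (√(a - 4 * y)) (√(a + b - 4 * y)) := by
        ext σ
        simp only [mem_inter_iff, mem_Ioo, mem_setOf_eq]
        constructor
        · rintro ⟨⟨h0, -⟩, hA, hB⟩
          exact ⟨(Real.sqrt_lt' h0).2 (by linarith), (Real.lt_sqrt h0.le).2 (by linarith)⟩
        · rintro ⟨hA, hB⟩
          have h0 : 0 < σ := (Real.sqrt_nonneg _).trans_lt hA
          have hA' := (Real.sqrt_lt' h0).1 hA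
          have hB' := (Real.lt_sqrt h0.le).1 hB
          exact ⟨⟨h0, (Real.lt_sqrt h0.le).2 (by linarith [hy.1])⟩, by linarith, by linarith⟩
      have hτ : √(a - 4 * y) ≤ √(a + b - 4 * y) := Real.sqrt_le_sqrt (by linarith)
      calc Φ y * y ^ M = (∫ σ in Ioo (√(a - 4 * y)) (√(a + b - 4 * y)), φ y σ) * y ^ M := by
            simp only [hΦ_def]
            rw [intervalIntegral.integral_of_le hτ, integral_Ioc_eq_integral_Ioo]
        _ = ∫ σ in Ioo (√(a - 4 * y)) (√(a + b - 4 * y)), 4 / b * G (S y σ, σ) := by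
            rw [← integral_mul_const]
            refine setIntegral_congr_fun measurableSet_Ioo fun σ hσ => ?_
            have h0 : 0 < σ := (Real.sqrt_nonneg _).trans_lt hσ.1
            have hA : (a - σ ^ 2) / 4 < y := by linarith [(Real.sqrt_lt' h0).1 hσ.1]
            simp only [hφ_def, hG_def]
            rw [show (w (S y σ) - σ ^ 2) / 4 = y by rw [hwS y σ hA]; ring]
            ring
        _ = ∫ σ in Ioo 0 √(a + b), ({σ : ℝ | (a - σ ^ 2) / 4 < y} ∩
              {σ | y < (a + b - σ ^ 2) / 4}).indicator (fun σ => 4 / b * G (S y σ, σ)) σ := by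
            rw [setIntegral_indicator ((measurableSet_lt (by fun_prop) measurable_const).inter
              (measurableSet_lt measurable_const (by fun_prop))), hset]
        _ = ∫ σ in Ioo 0 √(a + b), F₂ (σ, y) := by
            refine setIntegral_congr_fun measurableSet_Ioo fun σ _ => ?_
            simp only [hF₂_def, Set.indicator_apply, mem_inter_iff, mem_setOf_eq]
    rw [intervalIntegral.integral_of_le hL.le, integral_Ioc_eq_integral_Ioo]
    exact h6
  -- Weierstrass: `Φ` vanishes on `(0, (a+b)/4)`; unfold it at `y ∈ (a/4, (a+b)/4)`
  intro y hy
  have hy0 : 0 < y := lt_trans (by positivity) hy.1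
  have h4y : a < 4 * y := by linarith [hy.1]
  have hΦy : ∫ σ in Ioo 0 √(a + b - 4 * y), φ y σ = 0 := by
    have h := eq_zero_of_forall_moment_eq_zero hΦ_cont hΦmom ⟨hy0, hy.2⟩
    rw [hΦ_def] at h
    simp only at h
    rwa [Real.sqrt_eq_zero'.2 (by linarith), intervalIntegral.integral_of_le (Real.sqrt_nonneg _),
      integral_Ioc_eq_integral_Ioo] at h
  -- the substitution `s = S y σ` on `σ ∈ (0, √(a+b−4y))`
  have hderiv : ∀ σ ∈ Ioo 0 √(a + b - 4 * y),
      HasDerivWithinAt (S y) (2 * σ / b) (Ioo 0 √(a + b - 4 * y)) σ := fun σ _ => by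
    have h := (((hasDerivAt_pow 2 σ).const_add (4 * y)).sub_const a).div_const b
    rw [hS_def]
    refine (h.congr_deriv ?_).hasDerivWithinAt
    norm_num
  have hinj : InjOn (S y) (Ioo 0 √(a + b - 4 * y)) := by
    intro σ₁ h₁ σ₂ h₂ h
    rw [hS_def] at h
    have h' : σ₁ ^ 2 = σ₂ ^ 2 := by
      have := mul_right_cancel₀ (inv_ne_zero hb.ne') (h : _ = _)
      linarith
    exact (sq_eq_sq₀ h₁.1.le h₂.1.le).1 h'
  have himage : S y '' Ioo 0 √(a + b - 4 * y) = Ioo ((4 * y - a) / b) 1 := by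
    ext s
    rw [hS_def]
    simp only [mem_image, mem_Ioo]
    constructor
    · rintro ⟨σ, ⟨h0, h1⟩, rfl⟩
      have h1' := (Real.lt_sqrt h0.le).1 h1
      exact ⟨div_lt_div_of_pos_right (by nlinarith) hb, (div_lt_one hb).2 (by linarith)⟩
    · rintro ⟨h1, h2⟩
      rw [div_lt_iff₀ hb] at h1
      refine ⟨√(b * s + a - 4 * y), ⟨Real.sqrt_pos.2 (by linarith),
        Real.sqrt_lt_sqrt (by linarith) (by nlinarith)⟩, ?_⟩
      rw [Real.sq_sqrt (by linarith)]
      field_simp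
      ring
  rw [← himage, integral_image_eq_integral_abs_deriv_smul measurableSet_Ioo hderiv hinj]
  refine Eq.trans (setIntegral_congr_fun measurableSet_Ioo fun σ hσ => ?_) hΦy
  have h0 : 0 < σ := hσ.1
  have hA : (a - σ ^ 2) / 4 < y := by nlinarith
  have hr : 0 < 4 * y + σ ^ 2 := by positivity
  have hbS : a + b * S y σ = 4 * y + σ ^ 2 := by rw [hS_def]; field_simp; ring
  have hsq : √(1 - 4 * y / (a + b * S y σ)) = σ / √(4 * y + σ ^ 2) := by
    rw [hbS, show 1 - 4 * y / (4 * y + σ ^ 2) = σ ^ 2 / (4 * y + σ ^ 2) by field_simp; ring,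
      Real.sqrt_div (sq_nonneg σ), Real.sqrt_sq h0.le]
  simp only [hφ_def]
  rw [smul_eq_mul, abs_of_pos (by positivity : (0 : ℝ) < 2 * σ / b), hsq, hbS, hwS y σ hA]
  have hc : 0 < √(4 * y + σ ^ 2) := Real.sqrt_pos.2 hr
  have hcc : 4 * y + σ ^ 2 = √(4 * y + σ ^ 2) ^ 2 := (Real.sq_sqrt hr.le).symm
  set c := √(4 * y + σ ^ 2)
  rw [hcc]
  field_simp
  ring

end Summit.KontsevichZagierPeriods.InverseLandau.TateFamilyKernel.Descent

end
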